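import Mathlib
import Summits.NavierStokesRegularity.NavierStokesRegularity.Theorems.TaoLadderRungTwoBreakOneShiftWindowGridE
import HarnessLib

/-!
# The one-shift window system, LX: TABLE-HOISTED FORMS OF THE STEP BOOLEANS — `RoughStepD.checkKZA`,
# `PairStepD.checkPairA`, `PairStepD.checkA`, `GridD.stepOKA`, each PROVABLY EQUAL to the landed Boolean
# (`checkKZA_eq`, `checkPairA_eq`, `checkA_eq`, `stepOKA_eq`)
# (cell harvest/h2-tao-ladder, seat p2; rung1/KERNEL-CHEAP-REPLAY-SPEC.md §8; support for K1(1) = `NoSurvivingDSSOne`,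
# stmt-NavierStokesRegularity-20205)

WHY (emitter sizing, p2 g15): the landed `RoughStepD.checkKZ` / `PairStepD.checkPair` recompute the hull `Hs` (an `Array.ofFn`
over `n` entries) inside every Jacobian-row call and the proximity bound `proxD c` (two `n`-term rounded sums) inside every
closeness row, i.e. inside the `n × n` loops of `growthOK` / `pairOK`: ≈ 30·n³ ≈ 10⁹ interval operations at `n = 304` (an
evaluation time of ~10 h per step in the interpreter) for quantities that are FUNCTIONS OF THE ROW INDEX ONLY. Here the same
Booleans are restated with every row-indexed quantity materialised once (`Array.ofFn`) and read back through a total lookup with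
the original function as fallback (`lkF`), so that the hoisted form is EQUAL to the landed one by `funext` — no soundness argument
is repeated; the `native_decide` files evaluate the `…A` forms and the glue theorems consume the landed ones via the equalities.

MODEL lattice ODEs only (Tao 2016 §4 normal form on Tao's shift set `S`); nothing here is a statement about the Navier–Stokes
equations; no item is closed; no instance is evaluated here.
-/

-- the sub-problem namespace repeats the summit name by design (D-0017)
set_option linter.dupNamespace false

namespace Summit.NavierStokesRegularity.NavierStokesRegularity.Theorems

namespace DSSOneShift

open Summit.NavierStokesRegularity.NavierStokesRegularity.Theorems.TaylorModelCert
open Summit.NavierStokesRegularity.NavierStokesRegularity.Theorems.CertificateGlueOn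

/-! ### Total lookups with fallback -/

/-- Read `A[i]`, falling back to `f i` out of range. [folklore] -/
def lkF {α : Type} (A : Array α) (f : ℕ → α) (i : ℕ) : α := if h : i < A.size then A[i] else f i

/-- A table built from `f` reads back as `f`. [folklore] -/
theorem lkF_ofFn {α : Type} (n : ℕ) (f : ℕ → α) : lkF (Array.ofFn fun c : Fin n => f c) f = f := by
  funext i
  unfold lkF
  split
  · rw [Array.getElem_ofFn]
  · rfl

/-- Read the `(i, j)` entry of a row-major `n × n` table, falling back to `f i j`. [folklore] -/
def lkF2 {α : Type} (A : Array α) (n : ℕ) (f : ℕ → ℕ → α) (i j : ℕ) : α :=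
  if h : i < n ∧ j < n ∧ i * n + j < A.size then A[i * n + j] else f i j

/-- A row-major table built from `f` reads back as `f`. [folklore] -/
theorem lkF2_ofFn {α : Type} (n : ℕ) (f : ℕ → ℕ → α) :
    lkF2 (Array.ofFn fun t : Fin (n * n) => f (t.val / n) (t.val % n)) n f = f := by
  funext i j
  unfold lkF2
  split
  · rename_i h
    obtain ⟨hi, hj, hij⟩ := h
    rw [Array.getElem_ofFn]
    dsimp only
    have hn : 0 < n := Nat.zero_lt_of_lt hj
    rw [show (i * n + j) / n = i by rw [Nat.add_comm, Nat.add_mul_div_right _ _ hn, Nat.div_eq_of_lt hj, Nat.zero_add],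
      show (i * n + j) % n = j by rw [Nat.add_comm, Nat.add_mul_mod_self_right, Nat.mod_eq_of_lt hj]]
  · rfl

namespace RoughStepD

variable (d : RoughStepD)

/-- `R_cj` with the hull as an ARGUMENT. [folklore] -/
def RD'h (X : Array IntervalD) (c j : ℕ) : Dyad :=
  if c = j then Dyad.ofInt 0 else IntervalD.mag (jacRow d.prec X j (rrow d.RD c))

/-- At the step's own hull, `RD'h` is `RD'`. [folklore] -/
theorem RD'h_Hs : d.RD'h d.Hs = d.RD' := by
  funext c j; rfl

/-- `kzLhs` with the matrix `R` and the weights `E` as ARGUMENTS. [folklore] -/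
def kzLhsF (R : ℕ → ℕ → Dyad) (E : ℕ → Dyad) (c : ℕ) (v : ℕ → Dyad) (w : Dyad) : IntervalD :=
  IntervalD.mulR d.prec
    (IntervalD.addR d.prec
      (IntervalD.rangeSumR d.prec (fun j => IntervalD.mulR d.prec (IntervalD.ofDyad (R c j)) (IntervalD.ofDyad (v j))) d.n)
      (IntervalD.ofDyad w))
    (IntervalD.ofDyad (E c))

/-- At the step's own `R`, `E`, `kzLhsF` is `kzLhs`. [folklore] -/
theorem kzLhsF_eq : d.kzLhsF d.RD' d.ED = d.kzLhs := by
  funext c v w; rfl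

/-- **The rough-step test with hoisted tables** (`R`, `cb`, `E`, `xplus` materialised once). [cite: KapelaZgliczynski2009, §4 Lemma 4.1] -/
def checkKZA : Bool :=
  let X := d.Hs
  let Rt : Array Dyad := Array.ofFn fun t : Fin (d.n * d.n) => d.RD'h X (t.val / d.n) (t.val % d.n)
  let R := lkF2 Rt d.n d.RD'
  let cbt : Array Dyad := Array.ofFn fun c : Fin d.n => d.cbD c
  let cb := lkF cbt d.cbD
  let Et : Array Dyad := Array.ofFn fun c : Fin d.n => d.ED c
  let E := lkF Et d.ED
  let xpt : Array Dyad := Array.ofFn fun c : Fin d.n => d.xplus c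
  let xp := lkF xpt d.xplus
  Dyad.blt (Dyad.ofInt 0) d.eta &&
  (List.range d.n).all fun c =>
    Dyad.ble (Dyad.ofInt 0) (dget d.Zh c) && Dyad.blt (Dyad.ofInt 0) (dget d.zeta c) &&
    Dyad.ble (xp c) (Dyad.ofInt 1) &&
    IntervalD.hiLe (d.kzLhsF R E c (dget d.Zh) (cb c)) (dget d.Zh c) &&
    IntervalD.hiLe (d.kzLhsF R E c (dget d.zeta) (Dyad.ofInt 0)) (dget d.zeta c)

/-- **The hoisted rough-step test IS the landed one.** [folklore] -/
theorem checkKZA_eq : d.checkKZA = d.checkKZ := by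
  unfold checkKZA checkKZ
  simp only [RD'h_Hs, lkF2_ofFn, lkF_ofFn, kzLhsF_eq]

/-- The rough step's full test with the hoisted K–Z part. [folklore] -/
def checkA : Bool := d.centre.check && d.checkKZA

/-- [folklore] -/
theorem checkA_eq : d.checkA = d.check := by
  unfold checkA check; rw [checkKZA_eq]

end RoughStepD

namespace PairStepD

variable (d : PairStepD)

/-- The closeness row as a function of the proximity vector. [folklore] -/
def AdRowF (prox : ℕ → Dyad) (c : ℕ) : List (ℕ × Dyad) := adRow prox (d.row c)

/-- **The pair-step test with hoisted tables**: the hull, the proximity vector, the four families of sparse rows and the weights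
are materialised once and read back through `lkF`. [cite: KapelaZgliczynski2009, §4 Lemma 4.1 / Thm. 9] -/
def checkPairA : Bool :=
  let proxt : Array Dyad := Array.ofFn fun c : Fin d.n => d.proxD c
  let prox := lkF proxt d.proxD
  let Abt : Array (List (ℕ × Dyad)) := Array.ofFn fun c : Fin d.n => d.AbRow c
  let Ab := lkF Abt d.AbRow
  let Rrt : Array (List (ℕ × Dyad)) := Array.ofFn fun c : Fin d.n => d.RrRow c
  let Rr := lkF Rrt d.RrRow
  let Rct : Array (List (ℕ × Dyad)) := Array.ofFn fun c : Fin d.n => d.RcRow c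
  let Rc := lkF Rct d.RcRow
  let Adt : Array (List (ℕ × Dyad)) := Array.ofFn fun c : Fin d.n => d.AdRowF prox c
  let Ad := lkF Adt (d.AdRowF prox)
  let ERt : Array Dyad := Array.ofFn fun c : Fin d.n => d.ER c
  let ER := lkF ERt d.ER
  let EDt : Array Dyad := Array.ofFn fun c : Fin d.n => d.toRoughStepD.ED c
  let ED := lkF EDt d.toRoughStepD.ED
  let xpt : Array Dyad := Array.ofFn fun c : Fin d.n => d.xplusR c
  let xp := lkF xpt d.xplusR
  (List.range d.n).all fun i =>
    Dyad.blt (Dyad.ofInt 0) (RoughStepD.dget d.zetaR i) &&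
    Dyad.ble (xp i) (Dyad.ofInt 1) &&
    Dyad.ble (Dyad.ofInt 0) (prox i) &&
    IntervalD.hiLe (IntervalD.mulR d.prec (d.rowDot (Rr i) (RoughStepD.dget d.zetaR)) (IntervalD.ofDyad (ER i)))
      (RoughStepD.dget d.zetaR i) &&
    IntervalD.hiLe (IntervalD.mulR d.prec (d.rowDot (Rc i) (RoughStepD.dget d.zeta)) (IntervalD.ofDyad (ED i)))
      (RoughStepD.dget d.zeta i) &&
    (List.range d.n).all fun l =>
      Dyad.ble (Dyad.ofInt 0) (d.mget d.Zg i l) && Dyad.ble (Dyad.ofInt 0) (d.mget d.Zh2 i l) &&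
      IntervalD.hiLe
        (IntervalD.mulR d.prec
          (IntervalD.addR d.prec (d.rowDot (Rr i) fun c => d.mget d.Zg c l)
            (d.rowDot (Ab i) fun c => if c = l then Dyad.ofInt 1 else Dyad.ofInt 0))
          (IntervalD.ofDyad (ER i)))
        (d.mget d.Zg i l) &&
      IntervalD.hiLe
        (IntervalD.mulR d.prec
          (IntervalD.addR d.prec (d.rowDot (Rc i) fun c => d.mget d.Zh2 c l) (d.rowDot (Ad i) fun c => d.Wb c l))
          (IntervalD.ofDyad (d.toRoughStepD.ED i)))
        (d.mget d.Zh2 i l)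

/-- **The hoisted pair-step test IS the landed one.** [folklore] -/
theorem checkPairA_eq : d.checkPairA = d.checkPair := by
  unfold checkPairA checkPair growthOK pairOK AdRow
  simp only [lkF_ofFn]
  rfl

/-- The pair step's full test with hoisted tables. [folklore] -/
def checkA : Bool := d.toRoughStepD.checkA && d.checkPairA

/-- [folklore] -/
theorem checkA_eq : d.checkA = d.check := by
  unfold checkA check; rw [RoughStepD.checkA_eq, checkPairA_eq]

end PairStepD

namespace GridD

variable (g : GridD)

/-- The per-step Boolean with hoisted tables. [folklore] -/
def stepOKA (s : ℕ) : Bool := (g.step s).checkA && decide ((g.step s).n = g.n)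

/-- [folklore] -/
theorem stepOKA_eq (s : ℕ) : g.stepOKA s = g.stepOK s := by
  unfold stepOKA stepOK; rw [PairStepD.checkA_eq]

end GridD

end DSSOneShift

end Summit.NavierStokesRegularity.NavierStokesRegularity.Theorems
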